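import Mathlib
import Literature.Analysis.FluidPDE.ChoiEtAl2017PeriodicHouLuoHilbertL2
import Literature.Analysis.FluidPDE.ChoiEtAl2017PeriodicHouLuoSignPreservation
import HarnessLib

/-!
# Choi–Hou–Kiselev–Luo–Šverák–Yao 2017, §2/§4: UNIQUENESS of global smooth periodic solutions of
# the Hou–Luo model (the energy estimate behind "local well-posedness … (bkmq)")

HONEST FRAMING (cell ns-blowup GROUP B «PROFILE SEARCH», zones Z3-b′ / Z8 = the Hou–Luo boundary
MODEL): **1-D MODEL (Hou–Luo), not Euler/NS.** Proof-only companion of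
`ChoiEtAl2017PeriodicHouLuoBlowup.lean` (model, data class, the fact
`choiEtAl2017_periodicHouLuo_blowup`), `…HilbertL2.lean` (`‖(Qω)′‖₂ ≤ ‖ω‖₂`, `‖Qω‖₂ ≤ (Λ/π)‖ω‖₂`),
`…SignPreservation.lean` (`hasDerivAt_deriv_theta`: the `θ_x`-equation) and `…Velocity.lean`.
Source: K. Choi, T. Y. Hou, A. Kiselev, G. Luo, V. Šverák, Y. Yao, Comm. Pure Appl. Math. **70**
(2017) 2218–2243 = arXiv:1407.4776 [ChoiHouKiselevLuoSverakYao2017]. §2 p. 6: "the local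
well-posedness … (bkmq) … can be proved by standard arguments"; §4 p. 11: "Thanks to transport
structure of (hl), the evolution preserves the assumptions as long as the solution exists" — in
print the symmetry of the data persists because smooth solutions are UNIQUE and the reflected pair
is again a solution (`…Reflection.lean`). This file kernel-checks the uniqueness half by the
standard energy argument.

## What is proved (no definitions, no named facts; net debt 0)

* `exists_strip_bounds` — a global smooth `L`-periodic solution has `|ω|, |ω_x|, |θ|, |θ_x|,
  |θ_xx|, |u|, |u_x| ≤ B` on every time strip `[0,T] × ℝ` (joint `C^∞` on `{t ≥ 0}` +
  periodicity + compactness; `u = Qω` via `…Velocity.lean`).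
* `energy_dissipation_le` — the STATIC energy inequality: for `L`-periodic `f₁, f₂ ∈ C¹`,
  `g₁, g₂ ∈ C²`, `uᵢ = Qfᵢ`, with `|u₁′|, |f₂′|, |g₂′|, |g₂″| ≤ B`, the time-derivative integrand
  `G = 2w·w_t + 2ϑ·ϑ_t + 2ϑ_x·ϑ_{xt}` of `E = ∫₀ᴸ (w² + ϑ² + ϑ_x²)` (`w = f₁ − f₂`, `ϑ = g₁ − g₂`,
  the `_t` symbols being the right-hand sides of the HL system and of the `θ_x`-equation)
  satisfies `∫₀ᴸ G ≤ K·∫₀ᴸ (w² + ϑ² + ϑ_x²)`, `K = 6B + 1 + 3B(Λ/π)²` — by `G = −u₁·(w² + ϑ² + ϑ_x²)′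
  + R`, integration by parts (periodicity), the pointwise Young bounds, and the two `L²` bounds
  `∫(Qw)² ≤ (Λ/π)²∫w²`, `∫((Qw)′)² ≤ ∫w²` of `…HilbertL2.lean`.
* `hasDerivAt_energy`, `continuousWithinAt_energy` — `E(t)` of the difference of two global
  smooth solutions is differentiable on `(0,T)` with derivative `∫₀ᴸ G` (differentiation under the
  integral, constant dominating function from the strip bounds) and continuous on `[0,∞)`.
* **`IsGlobalSmoothPeriodicHouLuoSolution.unique`** — two global smooth `L`-periodic solutions
  (`L > 0`) from the same datum coincide for all `t ≥ 0` (`E′ ≤ KE`, `E(0) = 0`, Gronwall via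
  `antitoneOn_of_deriv_nonpos`; `E(t) = 0` forces equality of the continuous slices).

This is hypothesis (U) of `not_isGlobalSmooth_of_unique_of_lemma7` (`…Reflection.lean`): with it,
the discharge of `choiEtAl2017_periodicHouLuo_blowup` is closed modulo (E) Lemma 7 only.

WHAT THIS IS NOT: not Euler, not Navier–Stokes; no blow-up asserted — a uniqueness theorem for the
1-D periodic wall MODEL. `violates:` none — MODEL.
-/

noncomputable section

open Set Filter Real MeasureTheory intervalIntegral
open _root_.Topology

namespace Literature.Analysis.FluidPDE

namespace ChoiEtAl2017

/-! ### §1 Plumbing: slices of jointly smooth functions on the closed half-plane `{t ≥ 0}` -/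

/-- The closed half-plane `{t ≥ 0}` as a product set. [folklore] -/
private theorem halfPlane_eq' : {p : ℝ × ℝ | 0 ≤ p.1} = Ici (0 : ℝ) ×ˢ (univ : Set ℝ) := by
  ext p; simp

/-- The closed half-plane has unique differentiability. [folklore] -/
private theorem uniqueDiffOn_halfPlane : UniqueDiffOn ℝ {p : ℝ × ℝ | 0 ≤ p.1} := by
  rw [halfPlane_eq']
  exact (uniqueDiffOn_Ici 0).prod uniqueDiffOn_univ

/-- Slices of a jointly `Cⁿ` function on the closed half-plane are `Cⁿ` (for `t ≥ 0`). [folklore] -/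
private theorem contDiff_slice' {θ : ℝ → ℝ → ℝ} {n : WithTop ℕ∞}
    (hθ : ContDiffOn ℝ n (fun p : ℝ × ℝ => θ p.1 p.2) {p : ℝ × ℝ | 0 ≤ p.1}) {t : ℝ} (ht : 0 ≤ t) :
    ContDiff ℝ n (θ t) :=
  hθ.comp_contDiff (contDiff_const.prodMk contDiff_id) fun _ => ht

/-- On the closed half-plane, `deriv (θ t) x` is the within-derivative of `(t,x) ↦ θ t x` applied to
`(0,1)`. [folklore] -/
private theorem deriv_slice_eq_fderivWithin'' {θ : ℝ → ℝ → ℝ}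
    (hθ : ContDiffOn ℝ 1 (fun p : ℝ × ℝ => θ p.1 p.2) {p : ℝ × ℝ | 0 ≤ p.1}) {p : ℝ × ℝ}
    (hp : 0 ≤ p.1) :
    deriv (θ p.1) p.2 =
      fderivWithin ℝ (fun p : ℝ × ℝ => θ p.1 p.2) {p : ℝ × ℝ | 0 ≤ p.1} p ((0 : ℝ), (1 : ℝ)) := by
  have hd := (hθ.differentiableOn (by norm_num) p hp).hasFDerivWithinAt
  have hι : HasDerivWithinAt (fun x : ℝ => (p.1, x)) ((0 : ℝ), (1 : ℝ)) univ p.2 :=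
    ((hasDerivAt_const p.2 p.1).prodMk (hasDerivAt_id p.2)).hasDerivWithinAt
  have hmaps : MapsTo (fun x : ℝ => (p.1, x)) univ {p : ℝ × ℝ | 0 ≤ p.1} := fun x _ => hp
  exact ((hd.comp_hasDerivWithinAt p.2 hι hmaps).hasDerivAt univ_mem).deriv

/-- Joint continuity of `(t,x) ↦ deriv (θ t) x` on the closed half-plane. [folklore] -/
private theorem continuousOn_deriv_slice'' {θ : ℝ → ℝ → ℝ}
    (hθ : ContDiffOn ℝ 1 (fun p : ℝ × ℝ => θ p.1 p.2) {p : ℝ × ℝ | 0 ≤ p.1}) :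
    ContinuousOn (fun p : ℝ × ℝ => deriv (θ p.1) p.2) {p : ℝ × ℝ | 0 ≤ p.1} := by
  have hc := hθ.continuousOn_fderivWithin uniqueDiffOn_halfPlane le_rfl
  exact (hc.clm_apply continuousOn_const).congr fun p hp => deriv_slice_eq_fderivWithin'' hθ hp

/-- **The slice derivative is again jointly smooth**: if `(t,x) ↦ θ t x` is jointly `C²` on the
closed half-plane then `(t,x) ↦ θ_x(t,x)` is jointly `C¹` there. [folklore] -/
private theorem contDiffOn_deriv_slice {θ : ℝ → ℝ → ℝ}
    (hθ : ContDiffOn ℝ 2 (fun p : ℝ × ℝ => θ p.1 p.2) {p : ℝ × ℝ | 0 ≤ p.1}) :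
    ContDiffOn ℝ 1 (fun p : ℝ × ℝ => deriv (θ p.1) p.2) {p : ℝ × ℝ | 0 ≤ p.1} := by
  have h1 : ContDiffOn ℝ 1
      (fderivWithin ℝ (fun p : ℝ × ℝ => θ p.1 p.2) {p : ℝ × ℝ | 0 ≤ p.1}) {p : ℝ × ℝ | 0 ≤ p.1} :=
    hθ.fderivWithin uniqueDiffOn_halfPlane (le_of_eq one_add_one_eq_two)
  have h2 : ContDiffOn ℝ 1 (fun p : ℝ × ℝ =>
      fderivWithin ℝ (fun p : ℝ × ℝ => θ p.1 p.2) {p : ℝ × ℝ | 0 ≤ p.1} p ((0 : ℝ), (1 : ℝ)))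
      {p : ℝ × ℝ | 0 ≤ p.1} := h1.clm_apply contDiffOn_const
  exact h2.congr fun p hp => deriv_slice_eq_fderivWithin'' (hθ.of_le (by norm_num)) hp

/-- The derivative of an `L`-periodic function is `L`-periodic. [folklore] -/
private theorem periodic_deriv' {f : ℝ → ℝ} {L : ℝ} (hper : Function.Periodic f L) :
    Function.Periodic (deriv f) L := by
  intro y
  have h : (fun z => f (z + L)) = f := funext fun z => hper z
  rw [← deriv_comp_add_const, h]

/-- **A uniform bound on a time strip**: a function continuous on the closed half-plane with
`L`-periodic slices (`L > 0`) is bounded on `[0,T] × ℝ`. [folklore] -/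
private theorem exists_bound_of_continuousOn {Φ : ℝ → ℝ → ℝ} {L T : ℝ} (hL : 0 < L)
    (hΦ : ContinuousOn (fun p : ℝ × ℝ => Φ p.1 p.2) {p : ℝ × ℝ | 0 ≤ p.1})
    (hper : ∀ t ∈ Icc 0 T, Function.Periodic (Φ t) L) :
    ∃ M : ℝ, 0 ≤ M ∧ ∀ t ∈ Icc 0 T, ∀ x, |Φ t x| ≤ M := by
  have hcont := hΦ.mono
    (show Icc (0 : ℝ) T ×ˢ Icc (0 : ℝ) L ⊆ {p : ℝ × ℝ | 0 ≤ p.1} from fun p hp => hp.1.1)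
  obtain ⟨C, hC⟩ := (isCompact_Icc.prod isCompact_Icc).exists_bound_of_continuousOn hcont
  refine ⟨max C 0, le_max_right _ _, fun t ht x => ?_⟩
  obtain ⟨y, hy, hxy⟩ := (hper t ht).exists_mem_Ico₀ hL x
  rw [hxy]
  have h := hC (t, y) ⟨ht, ⟨hy.1, hy.2.le⟩⟩
  rw [Real.norm_eq_abs] at h
  exact h.trans (le_max_left _ _)

/-! ### §2 Strip bounds for a global smooth periodic HL solution -/

/-- **Sup-norm bounds on a time strip** for a global smooth `L`-periodic HL solution (`L > 0`,
`T > 0`): one constant `B ≥ 1` bounds `|ω|, |ω_x|, |θ|, |θ_x|, |θ_xx|, |u|, |u_x|` on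
`[0,T] × ℝ` (`u = Qω(t)`) — the finiteness of `sup`-norms "as long as the solution exists" that the
energy/BKM bookkeeping of §2/§4 uses. [cite: ChoiHouKiselevLuoSverakYao2017, §2 p. 6 (bkmq) and §4 p. 13 (‖θ_x‖_∞, ‖u_x‖_∞ finite for the smooth solution)] -/
theorem exists_strip_bounds {L T : ℝ} (hL : 0 < L) (hT : 0 < T) {ω₀ θ₀ : ℝ → ℝ}
    {ω θ : ℝ → ℝ → ℝ} (h : IsGlobalSmoothPeriodicHouLuoSolution L ω₀ θ₀ ω θ) :
    ∃ B : ℝ, 1 ≤ B ∧ ∀ s ∈ Icc 0 T, ∀ x,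
      |ω s x| ≤ B ∧ |deriv (ω s) x| ≤ B ∧ |θ s x| ≤ B ∧ |deriv (θ s) x| ≤ B ∧
      |deriv (deriv (θ s)) x| ≤ B ∧ |periodicHLVelocity L (ω s) x| ≤ B ∧
      |deriv (periodicHLVelocity L (ω s)) x| ≤ B := by
  obtain ⟨hsolT, hωs, hθs, -, -⟩ := h
  have hsol : IsPeriodicHouLuoSolution L ω θ (T + 1) := hsolT (T + 1) (by linarith)
  have hIcc : ∀ s ∈ Icc 0 T, s ∈ Ico 0 (T + 1) := fun s hs => ⟨hs.1, by linarith [hs.2]⟩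
  have hωper : ∀ s ∈ Icc 0 T, Function.Periodic (ω s) L := fun s hs => (hsol.1 s (hIcc s hs)).2.2.1
  have hθper : ∀ s ∈ Icc 0 T, Function.Periodic (θ s) L := fun s hs => (hsol.1 s (hIcc s hs)).2.2.2
  have hωs1 : ContDiffOn ℝ 1 (fun p : ℝ × ℝ => ω p.1 p.2) {p : ℝ × ℝ | 0 ≤ p.1} :=
    hωs.of_le (by exact_mod_cast (le_top : (1 : ℕ∞) ≤ ⊤))
  have hθs1 : ContDiffOn ℝ 1 (fun p : ℝ × ℝ => θ p.1 p.2) {p : ℝ × ℝ | 0 ≤ p.1} :=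
    hθs.of_le (by exact_mod_cast (le_top : (1 : ℕ∞) ≤ ⊤))
  have hθs2 : ContDiffOn ℝ 2 (fun p : ℝ × ℝ => θ p.1 p.2) {p : ℝ × ℝ | 0 ≤ p.1} :=
    (contDiffOn_infty.1 hθs) 2
  have hθx1 : ContDiffOn ℝ 1 (fun p : ℝ × ℝ => deriv (θ p.1) p.2) {p : ℝ × ℝ | 0 ≤ p.1} :=
    contDiffOn_deriv_slice hθs2
  have hωC1 : ∀ s ∈ Icc 0 T, ContDiff ℝ 1 (ω s) := fun s hs =>
    (contDiff_infty.1 (contDiff_slice' hωs hs.1)) 1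
  -- the five slice bounds
  obtain ⟨Mω, hMω0, hMω⟩ := exists_bound_of_continuousOn (T := T) hL hωs.continuousOn hωper
  obtain ⟨Mωx, hMωx0, hMωx⟩ := exists_bound_of_continuousOn (Φ := fun t x => deriv (ω t) x)
    (T := T) hL (continuousOn_deriv_slice'' hωs1) (fun s hs => periodic_deriv' (hωper s hs))
  obtain ⟨Mθ, hMθ0, hMθ⟩ := exists_bound_of_continuousOn (T := T) hL hθs.continuousOn hθper
  obtain ⟨Mθx, hMθx0, hMθx⟩ := exists_bound_of_continuousOn (Φ := fun t x => deriv (θ t) x)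
    (T := T) hL (continuousOn_deriv_slice'' hθs1) (fun s hs => periodic_deriv' (hθper s hs))
  obtain ⟨Mθxx, hMθxx0, hMθxx⟩ := exists_bound_of_continuousOn
    (Φ := fun t x => deriv (deriv (θ t)) x) (T := T) hL
    (continuousOn_deriv_slice'' (θ := fun t => deriv (θ t)) hθx1)
    (fun s hs => periodic_deriv' (periodic_deriv' (hθper s hs)))
  -- the velocity bounds
  set Λ : ℝ := ∫ z in (0 : ℝ)..L, |(Real.log |Real.sin (π * z / L)|)| with hΛ
  have hΛ0 : 0 ≤ Λ := intervalIntegral.integral_nonneg hL.le fun z _ => abs_nonneg _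
  have hu : ∀ s ∈ Icc 0 T, ∀ x, |periodicHLVelocity L (ω s) x| ≤ Mω / π * Λ := fun s hs x =>
    abs_periodicHLVelocity_le hL (hωC1 s hs).continuous (hωper s hs) (hMω s hs) x
  have hux : ∀ s ∈ Icc 0 T, ∀ x, |deriv (periodicHLVelocity L (ω s)) x| ≤ Mωx / π * Λ :=
    fun s hs x => abs_deriv_periodicHLVelocity_le hL (hωC1 s hs) (hωper s hs) (hMωx s hs) x
  have h1 : 0 ≤ Mω / π * Λ := by positivity
  have h2 : 0 ≤ Mωx / π * Λ := by positivity
  refine ⟨1 + Mω + Mωx + Mθ + Mθx + Mθxx + Mω / π * Λ + Mωx / π * Λ, by linarith,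
    fun s hs x => ⟨?_, ?_, ?_, ?_, ?_, ?_, ?_⟩⟩
  · linarith [hMω s hs x]
  · linarith [hMωx s hs x]
  · linarith [hMθ s hs x]
  · linarith [hMθx s hs x]
  · linarith [hMθxx s hs x]
  · linarith [hu s hs x]
  · linarith [hux s hs x]

/-! ### §3 The static energy inequality `∫₀ᴸ G ≤ K ∫₀ᴸ (w² + ϑ² + ϑ_x²)` -/

/-- Pointwise Young: `2xy·q ≤ B(x² + y²)` when `|q| ≤ B`. [folklore] -/
private theorem two_mul_mul_le {x y q B : ℝ} (hq : |q| ≤ B) : 2 * x * y * q ≤ B * (x ^ 2 + y ^ 2) := by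
  have h1 : 2 * x * y * q ≤ |2 * x * y * q| := le_abs_self _
  have h2 : |2 * x * y * q| = 2 * |x| * |y| * |q| := by
    simp only [abs_mul, abs_two]
  have h3 : 2 * |x| * |y| ≤ x ^ 2 + y ^ 2 := by
    nlinarith [sq_abs x, sq_abs y, sq_nonneg (|x| - |y|)]
  have h4 : 2 * |x| * |y| * |q| ≤ (x ^ 2 + y ^ 2) * B :=
    mul_le_mul h3 hq (abs_nonneg _) (by positivity)
  linarith

/-- Linearity of `Q`: `Q(f₁ − f₂) = Qf₁ − Qf₂` for continuous `f₁, f₂`. [folklore] -/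
private theorem periodicHLVelocity_sub {L : ℝ} {f₁ f₂ : ℝ → ℝ} (hf₁ : Continuous f₁)
    (hf₂ : Continuous f₂) (x : ℝ) :
    periodicHLVelocity L (fun y => f₁ y - f₂ y) x =
      periodicHLVelocity L f₁ x - periodicHLVelocity L f₂ x := by
  unfold periodicHLVelocity
  rw [← mul_sub, ← intervalIntegral.integral_sub (intervalIntegrable_mul_log_abs_sin_sub hf₁ L x 0 L)
    (intervalIntegrable_mul_log_abs_sin_sub hf₂ L x 0 L)]
  congr 1
  refine intervalIntegral.integral_congr fun y _ => ?_
  ring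

/-- `deriv (f₁ − f₂) = deriv f₁ − deriv f₂` for `C¹` functions, as functions. [folklore] -/
private theorem deriv_sub_fun {f₁ f₂ : ℝ → ℝ} (hf₁ : ContDiff ℝ 1 f₁) (hf₂ : ContDiff ℝ 1 f₂) :
    deriv (fun y => f₁ y - f₂ y) = fun y => deriv f₁ y - deriv f₂ y := by
  funext y
  exact ((hf₁.differentiable (by norm_num) y).hasDerivAt.sub
    (hf₂.differentiable (by norm_num) y).hasDerivAt).deriv

/-- The pointwise bound behind `E′ ≤ KE`: with `|p|, |q|, |r|, |s| ≤ B` (`B ≥ 0`),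
`p(a²+b²+c²) + [−2·vv·q·a + 2ca − 2·vv·r·b − 2pc² − 2·vx·r·c − 2·vv·s·c]
 ≤ (5B+1)(a²+b²+c²) + 3B·vv² + B·vx²`. [folklore] -/
private theorem pointwise_energy_bound {a b c vv vx p q r s B : ℝ} (hB : 0 ≤ B) (hp : |p| ≤ B)
    (hq : |q| ≤ B) (hr : |r| ≤ B) (hs : |s| ≤ B) :
    p * (a ^ 2 + b ^ 2 + c ^ 2) +
        (-(2 * vv * q * a) + 2 * c * a - 2 * vv * r * b - 2 * p * c ^ 2 - 2 * vx * r * c -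
          2 * vv * s * c) ≤
      (5 * B + 1) * (a ^ 2 + b ^ 2 + c ^ 2) + 3 * B * vv ^ 2 + B * vx ^ 2 := by
  have t1 : p * (a ^ 2 + b ^ 2 + c ^ 2) ≤ B * (a ^ 2 + b ^ 2 + c ^ 2) :=
    mul_le_mul_of_nonneg_right ((le_abs_self p).trans hp) (by positivity)
  have t2 : -(2 * vv * q * a) ≤ B * (vv ^ 2 + a ^ 2) := by
    have h := two_mul_mul_le (x := -vv) (y := a) hq
    have : 2 * -vv * a * q = -(2 * vv * q * a) := by ring
    rw [this, neg_sq] at h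
    exact h
  have t3 : 2 * c * a ≤ c ^ 2 + a ^ 2 := by nlinarith [sq_nonneg (c - a)]
  have t4 : -(2 * vv * r * b) ≤ B * (vv ^ 2 + b ^ 2) := by
    have h := two_mul_mul_le (x := -vv) (y := b) hr
    have : 2 * -vv * b * r = -(2 * vv * r * b) := by ring
    rw [this, neg_sq] at h
    exact h
  have t5 : -(2 * p * c ^ 2) ≤ 2 * B * c ^ 2 := by
    have hp' : -p ≤ B := (neg_le_abs p).trans hp
    nlinarith [sq_nonneg c]
  have t6 : -(2 * vx * r * c) ≤ B * (vx ^ 2 + c ^ 2) := by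
    have h := two_mul_mul_le (x := -vx) (y := c) hr
    have : 2 * -vx * c * r = -(2 * vx * r * c) := by ring
    rw [this, neg_sq] at h
    exact h
  have t7 : -(2 * vv * s * c) ≤ B * (vv ^ 2 + c ^ 2) := by
    have h := two_mul_mul_le (x := -vv) (y := c) hs
    have : 2 * -vv * c * s = -(2 * vv * s * c) := by ring
    rw [this, neg_sq] at h
    exact h
  have ha : 0 ≤ B * a ^ 2 := mul_nonneg hB (sq_nonneg _)
  have hb : 0 ≤ B * b ^ 2 := mul_nonneg hB (sq_nonneg _)
  have hb' : 0 ≤ b ^ 2 := sq_nonneg _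
  linarith

/-- **The static energy inequality.** Let `L > 0`; `f₁, f₂ ∈ C¹(ℝ)` and `g₁, g₂ ∈ C²(ℝ)` all
`L`-periodic; `uᵢ = Qfᵢ`; and `|u₁′|, |f₂′|, |g₂′|, |g₂″| ≤ B` (`B ≥ 0`). With `w = f₁ − f₂`,
`ϑ = g₁ − g₂` and the HL right-hand sides `ωᵢ_t := −uᵢfᵢ′ + gᵢ′`, `θᵢ_t := −uᵢgᵢ′`,
`(θᵢ)_{xt} := −(uᵢgᵢ″ + uᵢ′gᵢ′)`, the energy-derivative integrand
`G = 2w(ω₁_t − ω₂_t) + 2ϑ(θ₁_t − θ₂_t) + 2ϑ_x((θ₁)_{xt} − (θ₂)_{xt})` satisfies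
`∫₀ᴸ G ≤ (6B + 1 + 3B(Λ/π)²) · ∫₀ᴸ (w² + ϑ² + ϑ_x²)`, `Λ = ∫₀ᴸ|log|sin(πz/L)||`.
Proof: `G = −u₁·(w² + ϑ² + ϑ_x²)′ + R` pointwise; `∫ −u₁P′ = ∫ u₁′P` (parts, periodicity);
`u₁′P + R ≤ (5B+1)P + 3B v² + B v_x²` pointwise (`v = u₁ − u₂ = Qw`); and
`∫v² ≤ (Λ/π)²∫w²`, `∫v_x² ≤ ∫w²` (`…HilbertL2.lean`). This is the standard energy estimate of
the local well-posedness theory the paper invokes ("(bkmq) … standard arguments", §2 p. 6).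
[cite: ChoiHouKiselevLuoSverakYao2017, §2 p. 6 (bkmq: local well-posedness) and §4 p. 11 (u = Qω, u_x = Hω)] -/
theorem energy_dissipation_le {L : ℝ} (hL : 0 < L) {f₁ f₂ g₁ g₂ : ℝ → ℝ}
    (hf₁ : ContDiff ℝ 1 f₁) (hf₂ : ContDiff ℝ 1 f₂) (hg₁ : ContDiff ℝ 2 g₁) (hg₂ : ContDiff ℝ 2 g₂)
    (pf₁ : Function.Periodic f₁ L) (pf₂ : Function.Periodic f₂ L)
    (pg₁ : Function.Periodic g₁ L) (pg₂ : Function.Periodic g₂ L) {B : ℝ} (hB : 0 ≤ B)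
    (hbd : ∀ x, |deriv (periodicHLVelocity L f₁) x| ≤ B ∧ |deriv f₂ x| ≤ B ∧ |deriv g₂ x| ≤ B ∧
      |deriv (deriv g₂) x| ≤ B) :
    (∫ x in (0 : ℝ)..L,
      (2 * (f₁ x - f₂ x) *
          ((-(periodicHLVelocity L f₁ x * deriv f₁ x) + deriv g₁ x) -
            (-(periodicHLVelocity L f₂ x * deriv f₂ x) + deriv g₂ x)) +
        2 * (g₁ x - g₂ x) *
          (-(periodicHLVelocity L f₁ x * deriv g₁ x) - -(periodicHLVelocity L f₂ x * deriv g₂ x)) +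
        2 * (deriv g₁ x - deriv g₂ x) *
          (-(periodicHLVelocity L f₁ x * deriv (deriv g₁) x +
              deriv (periodicHLVelocity L f₁) x * deriv g₁ x) -
            -(periodicHLVelocity L f₂ x * deriv (deriv g₂) x +
              deriv (periodicHLVelocity L f₂) x * deriv g₂ x)))) ≤
      (6 * B + 1 + 3 * B * (1 / π * ∫ z in (0 : ℝ)..L, |(Real.log |Real.sin (π * z / L)|)|) ^ 2) *
        ∫ x in (0 : ℝ)..L, ((f₁ x - f₂ x) ^ 2 + (g₁ x - g₂ x) ^ 2 + (deriv g₁ x - deriv g₂ x) ^ 2) := by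
  -- notation
  set u₁ : ℝ → ℝ := periodicHLVelocity L f₁ with hu₁
  set u₂ : ℝ → ℝ := periodicHLVelocity L f₂ with hu₂
  set C : ℝ := 1 / π * ∫ z in (0 : ℝ)..L, |(Real.log |Real.sin (π * z / L)|)| with hC
  set P : ℝ → ℝ := fun x => (f₁ x - f₂ x) ^ 2 + (g₁ x - g₂ x) ^ 2 + (deriv g₁ x - deriv g₂ x) ^ 2
    with hP
  set P' : ℝ → ℝ := fun x => 2 * (f₁ x - f₂ x) * (deriv f₁ x - deriv f₂ x) +
    2 * (g₁ x - g₂ x) * (deriv g₁ x - deriv g₂ x) +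
    2 * (deriv g₁ x - deriv g₂ x) * (deriv (deriv g₁) x - deriv (deriv g₂) x) with hP'
  set R : ℝ → ℝ := fun x =>
    -(2 * (u₁ x - u₂ x) * deriv f₂ x * (f₁ x - f₂ x)) +
    2 * (deriv g₁ x - deriv g₂ x) * (f₁ x - f₂ x) -
    2 * (u₁ x - u₂ x) * deriv g₂ x * (g₁ x - g₂ x) -
    2 * deriv u₁ x * (deriv g₁ x - deriv g₂ x) ^ 2 -
    2 * (deriv u₁ x - deriv u₂ x) * deriv g₂ x * (deriv g₁ x - deriv g₂ x) -
    2 * (u₁ x - u₂ x) * deriv (deriv g₂) x * (deriv g₁ x - deriv g₂ x) with hR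
  -- regularity facts
  have hf₁c : Continuous f₁ := hf₁.continuous
  have hf₂c : Continuous f₂ := hf₂.continuous
  have hg₁c : Continuous g₁ := hg₁.continuous
  have hg₂c : Continuous g₂ := hg₂.continuous
  have hf₁' : Continuous (deriv f₁) := hf₁.continuous_deriv le_rfl
  have hf₂' : Continuous (deriv f₂) := hf₂.continuous_deriv le_rfl
  have hg₁1 : ContDiff ℝ 1 g₁ := hg₁.of_le (by norm_num)
  have hg₂1 : ContDiff ℝ 1 g₂ := hg₂.of_le (by norm_num)
  have hg₁' : ContDiff ℝ 1 (deriv g₁) := by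
    have := (contDiff_succ_iff_deriv.1
      (show ContDiff ℝ ((1 : ℕ) + 1) g₁ by exact_mod_cast hg₁)).2.2
    exact_mod_cast this
  have hg₂' : ContDiff ℝ 1 (deriv g₂) := by
    have := (contDiff_succ_iff_deriv.1
      (show ContDiff ℝ ((1 : ℕ) + 1) g₂ by exact_mod_cast hg₂)).2.2
    exact_mod_cast this
  have hg₁'c : Continuous (deriv g₁) := hg₁'.continuous
  have hg₂'c : Continuous (deriv g₂) := hg₂'.continuous
  have hg₁'' : Continuous (deriv (deriv g₁)) := hg₁'.continuous_deriv le_rfl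
  have hg₂'' : Continuous (deriv (deriv g₂)) := hg₂'.continuous_deriv le_rfl
  have hu₁1 : ContDiff ℝ 1 u₁ := contDiff_periodicHLVelocity hL 1 (by exact_mod_cast hf₁) pf₁
  have hu₂1 : ContDiff ℝ 1 u₂ := contDiff_periodicHLVelocity hL 1 (by exact_mod_cast hf₂) pf₂
  have hu₁c : Continuous u₁ := hu₁1.continuous
  have hu₂c : Continuous u₂ := hu₂1.continuous
  have hu₁' : Continuous (deriv u₁) := hu₁1.continuous_deriv le_rfl
  have hu₂' : Continuous (deriv u₂) := hu₂1.continuous_deriv le_rfl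
  have hu₁per : Function.Periodic u₁ L := periodic_periodicHLVelocity hL.ne' f₁
  -- Step 1: the pointwise identity `G = −u₁ P′ + R`
  have hGeq : ∀ x,
      2 * (f₁ x - f₂ x) * ((-(u₁ x * deriv f₁ x) + deriv g₁ x) - (-(u₂ x * deriv f₂ x) + deriv g₂ x)) +
        2 * (g₁ x - g₂ x) * (-(u₁ x * deriv g₁ x) - -(u₂ x * deriv g₂ x)) +
        2 * (deriv g₁ x - deriv g₂ x) *
          (-(u₁ x * deriv (deriv g₁) x + deriv u₁ x * deriv g₁ x) -
            -(u₂ x * deriv (deriv g₂) x + deriv u₂ x * deriv g₂ x)) =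
      -(u₁ x * P' x) + R x := by
    intro x
    simp only [hP', hR]
    ring
  -- Step 2: integration by parts `∫ −u₁ P′ = ∫ u₁′ P`
  have hPder : ∀ x, HasDerivAt P (P' x) x := by
    intro x
    have e1 : HasDerivAt (fun y => (f₁ y - f₂ y) ^ 2)
        (((2 : ℕ) : ℝ) * (f₁ x - f₂ x) ^ (2 - 1) * (deriv f₁ x - deriv f₂ x)) x :=
      ((hf₁.differentiable (by norm_num) x).hasDerivAt.sub
        (hf₂.differentiable (by norm_num) x).hasDerivAt).pow 2
    have e2 : HasDerivAt (fun y => (g₁ y - g₂ y) ^ 2)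
        (((2 : ℕ) : ℝ) * (g₁ x - g₂ x) ^ (2 - 1) * (deriv g₁ x - deriv g₂ x)) x :=
      ((hg₁1.differentiable (by norm_num) x).hasDerivAt.sub
        (hg₂1.differentiable (by norm_num) x).hasDerivAt).pow 2
    have e3 : HasDerivAt (fun y => (deriv g₁ y - deriv g₂ y) ^ 2)
        (((2 : ℕ) : ℝ) * (deriv g₁ x - deriv g₂ x) ^ (2 - 1) *
          (deriv (deriv g₁) x - deriv (deriv g₂) x)) x :=
      ((hg₁'.differentiable (by norm_num) x).hasDerivAt.sub
        (hg₂'.differentiable (by norm_num) x).hasDerivAt).pow 2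
    have e := (e1.add e2).add e3
    refine (e.congr_deriv ?_)
    simp only [hP']
    push_cast
    ring
  have hu₁der : ∀ x, HasDerivAt u₁ (deriv u₁ x) x := fun x =>
    (hu₁1.differentiable (by norm_num) x).hasDerivAt
  have hPper : Function.Periodic P L := by
    intro x
    simp only [hP]
    rw [pf₁ x, pf₂ x, pg₁ x, pg₂ x, periodic_deriv' pg₁ x, periodic_deriv' pg₂ x]
  have hPc : Continuous P := by
    simp only [hP]
    fun_prop
  have hP'c : Continuous P' := by
    simp only [hP']
    fun_prop
  have hparts : (∫ x in (0 : ℝ)..L, u₁ x * P' x) = -∫ x in (0 : ℝ)..L, deriv u₁ x * P x := by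
    rw [intervalIntegral.integral_mul_deriv_eq_deriv_mul (fun x _ => hu₁der x) (fun x _ => hPder x)
      (hu₁'.intervalIntegrable _ _) (hP'c.intervalIntegrable _ _)]
    have hb : u₁ L * P L - u₁ 0 * P 0 = 0 := by
      have e1 := hu₁per 0
      have e2 := hPper 0
      rw [zero_add] at e1 e2
      rw [e1, e2, sub_self]
    rw [hb, zero_sub]
  -- Step 3: the pointwise bound `u₁′P + R ≤ (5B+1)P + 3B v² + B v_x²`
  have hpt : ∀ x, deriv u₁ x * P x + R x ≤
      (5 * B + 1) * P x + 3 * B * (u₁ x - u₂ x) ^ 2 + B * (deriv u₁ x - deriv u₂ x) ^ 2 := by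
    intro x
    obtain ⟨hbu, hbf, hbg, hbgg⟩ := hbd x
    simp only [hP, hR]
    exact pointwise_energy_bound hB hbu hbf hbg hbgg
  -- Step 4: integrate
  have hGint : (∫ x in (0 : ℝ)..L,
      (2 * (f₁ x - f₂ x) * ((-(u₁ x * deriv f₁ x) + deriv g₁ x) - (-(u₂ x * deriv f₂ x) + deriv g₂ x)) +
        2 * (g₁ x - g₂ x) * (-(u₁ x * deriv g₁ x) - -(u₂ x * deriv g₂ x)) +
        2 * (deriv g₁ x - deriv g₂ x) *
          (-(u₁ x * deriv (deriv g₁) x + deriv u₁ x * deriv g₁ x) -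
            -(u₂ x * deriv (deriv g₂) x + deriv u₂ x * deriv g₂ x)))) =
      ∫ x in (0 : ℝ)..L, (deriv u₁ x * P x + R x) := by
    have hRc : Continuous R := by
      simp only [hR]
      fun_prop
    have i1 : IntervalIntegrable (fun x => -(u₁ x * P' x)) volume 0 L :=
      ((hu₁c.mul hP'c).neg).intervalIntegrable _ _
    have i2 : IntervalIntegrable (fun x => R x) volume 0 L := hRc.intervalIntegrable _ _
    have i3 : IntervalIntegrable (fun x => deriv u₁ x * P x) volume 0 L :=
      (hu₁'.mul hPc).intervalIntegrable _ _
    have e1 : (∫ x in (0 : ℝ)..L, (-(u₁ x * P' x) + R x)) =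
        (∫ x in (0 : ℝ)..L, -(u₁ x * P' x)) + ∫ x in (0 : ℝ)..L, R x :=
      intervalIntegral.integral_add i1 i2
    have e2 : (∫ x in (0 : ℝ)..L, (deriv u₁ x * P x + R x)) =
        (∫ x in (0 : ℝ)..L, deriv u₁ x * P x) + ∫ x in (0 : ℝ)..L, R x :=
      intervalIntegral.integral_add i3 i2
    rw [intervalIntegral.integral_congr (fun x _ => hGeq x), e1, e2, intervalIntegral.integral_neg,
      hparts, neg_neg]
  rw [hGint]
  -- the two `L²` bounds for `v = Q(f₁ − f₂)`
  have hw1 : ContDiff ℝ 1 (fun y => f₁ y - f₂ y) := hf₁.sub hf₂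
  have hwper : Function.Periodic (fun y => f₁ y - f₂ y) L := by
    intro y
    show f₁ (y + L) - f₂ (y + L) = f₁ y - f₂ y
    rw [pf₁ y, pf₂ y]
  have hv : ∀ x, periodicHLVelocity L (fun y => f₁ y - f₂ y) x = u₁ x - u₂ x := fun x =>
    periodicHLVelocity_sub hf₁c hf₂c x
  have hdu₁ : deriv u₁ = periodicHLVelocity L (deriv f₁) := deriv_periodicHLVelocity hL hf₁ pf₁
  have hdu₂ : deriv u₂ = periodicHLVelocity L (deriv f₂) := deriv_periodicHLVelocity hL hf₂ pf₂
  have hvx : ∀ x, deriv (periodicHLVelocity L (fun y => f₁ y - f₂ y)) x = deriv u₁ x - deriv u₂ x := by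
    intro x
    rw [deriv_periodicHLVelocity hL hw1 hwper, deriv_sub_fun hf₁ hf₂,
      periodicHLVelocity_sub hf₁' hf₂' x, hdu₁, hdu₂]
  have hwc : Continuous (fun y => f₁ y - f₂ y) := hf₁c.sub hf₂c
  have hL2v : (∫ x in (0 : ℝ)..L, (u₁ x - u₂ x) ^ 2) ≤ C ^ 2 * ∫ x in (0 : ℝ)..L, (f₁ x - f₂ x) ^ 2 := by
    have h := integral_sq_periodicHLVelocity_le hL (ω := fun y => f₁ y - f₂ y) hwc hwper
    have e : (∫ x in (0 : ℝ)..L, (periodicHLVelocity L (fun y => f₁ y - f₂ y) x) ^ 2) =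
        ∫ x in (0 : ℝ)..L, (u₁ x - u₂ x) ^ 2 :=
      intervalIntegral.integral_congr fun x _ => by rw [hv x]
    rw [e] at h
    exact h
  have hL2vx : (∫ x in (0 : ℝ)..L, (deriv u₁ x - deriv u₂ x) ^ 2) ≤
      ∫ x in (0 : ℝ)..L, (f₁ x - f₂ x) ^ 2 := by
    have h := integral_sq_deriv_periodicHLVelocity_le hL (ω := fun y => f₁ y - f₂ y) hw1 hwper
    have e : (∫ x in (0 : ℝ)..L, (deriv (periodicHLVelocity L (fun y => f₁ y - f₂ y)) x) ^ 2) =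
        ∫ x in (0 : ℝ)..L, (deriv u₁ x - deriv u₂ x) ^ 2 :=
      intervalIntegral.integral_congr fun x _ => by rw [hvx x]
    rw [e] at h
    exact h
  have hwP : (∫ x in (0 : ℝ)..L, (f₁ x - f₂ x) ^ 2) ≤ ∫ x in (0 : ℝ)..L, P x := by
    have i0 : IntervalIntegrable (fun x => (f₁ x - f₂ x) ^ 2) volume 0 L :=
      (hwc.pow 2).intervalIntegrable _ _
    refine intervalIntegral.integral_mono_on hL.le i0 (hPc.intervalIntegrable _ _) fun x _ => ?_
    simp only [hP]
    nlinarith [sq_nonneg (g₁ x - g₂ x), sq_nonneg (deriv g₁ x - deriv g₂ x)]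
  have hP0 : 0 ≤ ∫ x in (0 : ℝ)..L, P x :=
    intervalIntegral.integral_nonneg hL.le fun x _ => by simp only [hP]; positivity
  have hC0 : 0 ≤ C := by
    rw [hC]
    exact mul_nonneg (by positivity)
      (intervalIntegral.integral_nonneg hL.le fun z _ => abs_nonneg _)
  -- integrate the pointwise bound
  have hint1 : (∫ x in (0 : ℝ)..L, (deriv u₁ x * P x + R x)) ≤
      ∫ x in (0 : ℝ)..L, ((5 * B + 1) * P x + 3 * B * (u₁ x - u₂ x) ^ 2 +
        B * (deriv u₁ x - deriv u₂ x) ^ 2) := by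
    have hRc : Continuous R := by
      simp only [hR]
      fun_prop
    have j1 : IntervalIntegrable (fun x => deriv u₁ x * P x + R x) volume 0 L :=
      ((hu₁'.mul hPc).add hRc).intervalIntegrable _ _
    have j2 : IntervalIntegrable (fun x => (5 * B + 1) * P x + 3 * B * (u₁ x - u₂ x) ^ 2 +
        B * (deriv u₁ x - deriv u₂ x) ^ 2) volume 0 L :=
      (((continuous_const.mul hPc).add (continuous_const.mul ((hu₁c.sub hu₂c).pow 2))).add
        (continuous_const.mul ((hu₁'.sub hu₂').pow 2))).intervalIntegrable _ _
    exact intervalIntegral.integral_mono_on hL.le j1 j2 fun x _ => hpt x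
  have hsplit : (∫ x in (0 : ℝ)..L, ((5 * B + 1) * P x + 3 * B * (u₁ x - u₂ x) ^ 2 +
        B * (deriv u₁ x - deriv u₂ x) ^ 2)) =
      (5 * B + 1) * (∫ x in (0 : ℝ)..L, P x) + 3 * B * (∫ x in (0 : ℝ)..L, (u₁ x - u₂ x) ^ 2) +
        B * ∫ x in (0 : ℝ)..L, (deriv u₁ x - deriv u₂ x) ^ 2 := by
    have i1 : IntervalIntegrable (fun x => (5 * B + 1) * P x) volume 0 L :=
      (continuous_const.mul hPc).intervalIntegrable _ _
    have i2 : IntervalIntegrable (fun x => 3 * B * (u₁ x - u₂ x) ^ 2) volume 0 L :=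
      (continuous_const.mul ((hu₁c.sub hu₂c).pow 2)).intervalIntegrable _ _
    have i3 : IntervalIntegrable (fun x => B * (deriv u₁ x - deriv u₂ x) ^ 2) volume 0 L :=
      (continuous_const.mul ((hu₁'.sub hu₂').pow 2)).intervalIntegrable _ _
    rw [intervalIntegral.integral_add (i1.add i2) i3, intervalIntegral.integral_add i1 i2,
      intervalIntegral.integral_const_mul, intervalIntegral.integral_const_mul,
      intervalIntegral.integral_const_mul]
  rw [hsplit] at hint1
  have h3 : 3 * B * (∫ x in (0 : ℝ)..L, (u₁ x - u₂ x) ^ 2) ≤ 3 * B * C ^ 2 * ∫ x in (0 : ℝ)..L, P x := by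
    have := mul_le_mul_of_nonneg_left (hL2v.trans (mul_le_mul_of_nonneg_left hwP (sq_nonneg C)))
      (show 0 ≤ 3 * B by positivity)
    linarith
  have h4 : B * (∫ x in (0 : ℝ)..L, (deriv u₁ x - deriv u₂ x) ^ 2) ≤ B * ∫ x in (0 : ℝ)..L, P x :=
    mul_le_mul_of_nonneg_left (hL2vx.trans hwP) hB
  calc (∫ x in (0 : ℝ)..L, (deriv u₁ x * P x + R x))
      ≤ (5 * B + 1) * (∫ x in (0 : ℝ)..L, P x) + 3 * B * (∫ x in (0 : ℝ)..L, (u₁ x - u₂ x) ^ 2) +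
        B * ∫ x in (0 : ℝ)..L, (deriv u₁ x - deriv u₂ x) ^ 2 := hint1
    _ ≤ (5 * B + 1) * (∫ x in (0 : ℝ)..L, P x) + 3 * B * C ^ 2 * (∫ x in (0 : ℝ)..L, P x) +
        B * ∫ x in (0 : ℝ)..L, P x := by linarith
    _ = (6 * B + 1 + 3 * B * C ^ 2) * ∫ x in (0 : ℝ)..L, P x := by ring

/-- Two global smooth solutions admit ONE constant bounding all fourteen strip quantities.
[cite: ChoiHouKiselevLuoSverakYao2017, §2 p. 6 (bkmq) and §4 p. 13 (finite sup norms of the smooth solution)] -/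
theorem exists_strip_bounds₂ {L T : ℝ} (hL : 0 < L) (hT : 0 < T) {ω₀ θ₀ : ℝ → ℝ}
    {ω₁ θ₁ ω₂ θ₂ : ℝ → ℝ → ℝ} (h₁ : IsGlobalSmoothPeriodicHouLuoSolution L ω₀ θ₀ ω₁ θ₁)
    (h₂ : IsGlobalSmoothPeriodicHouLuoSolution L ω₀ θ₀ ω₂ θ₂) :
    ∃ B : ℝ, 1 ≤ B ∧
      (∀ s ∈ Icc 0 T, ∀ x,
        |ω₁ s x| ≤ B ∧ |deriv (ω₁ s) x| ≤ B ∧ |θ₁ s x| ≤ B ∧ |deriv (θ₁ s) x| ≤ B ∧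
        |deriv (deriv (θ₁ s)) x| ≤ B ∧ |periodicHLVelocity L (ω₁ s) x| ≤ B ∧
        |deriv (periodicHLVelocity L (ω₁ s)) x| ≤ B) ∧
      (∀ s ∈ Icc 0 T, ∀ x,
        |ω₂ s x| ≤ B ∧ |deriv (ω₂ s) x| ≤ B ∧ |θ₂ s x| ≤ B ∧ |deriv (θ₂ s) x| ≤ B ∧
        |deriv (deriv (θ₂ s)) x| ≤ B ∧ |periodicHLVelocity L (ω₂ s) x| ≤ B ∧
        |deriv (periodicHLVelocity L (ω₂ s)) x| ≤ B) := by
  obtain ⟨B₁, hB₁, hb₁⟩ := exists_strip_bounds hL hT h₁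
  obtain ⟨B₂, hB₂, hb₂⟩ := exists_strip_bounds hL hT h₂
  refine ⟨max B₁ B₂, le_max_of_le_left hB₁, fun s hs x => ?_, fun s hs x => ?_⟩
  · obtain ⟨e1, e2, e3, e4, e5, e6, e7⟩ := hb₁ s hs x
    exact ⟨e1.trans (le_max_left _ _), e2.trans (le_max_left _ _), e3.trans (le_max_left _ _),
      e4.trans (le_max_left _ _), e5.trans (le_max_left _ _), e6.trans (le_max_left _ _),
      e7.trans (le_max_left _ _)⟩
  · obtain ⟨e1, e2, e3, e4, e5, e6, e7⟩ := hb₂ s hs x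
    exact ⟨e1.trans (le_max_right _ _), e2.trans (le_max_right _ _), e3.trans (le_max_right _ _),
      e4.trans (le_max_right _ _), e5.trans (le_max_right _ _), e6.trans (le_max_right _ _),
      e7.trans (le_max_right _ _)⟩

/-! ### §4 The energy of the difference of two solutions: derivative and continuity -/

/-- `|a − b| ≤ |a| + |b|`. [folklore] -/
private theorem abs_sub_le_add (a b : ℝ) : |a - b| ≤ |a| + |b| := by
  rw [sub_eq_add_neg]
  simpa only [abs_neg] using abs_add_le a (-b)

/-- `|xy| ≤ B²` when `|x|, |y| ≤ B`, `B ≥ 0`. [folklore] -/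
private theorem abs_mul_le_sq {x y B : ℝ} (hB : 0 ≤ B) (hx : |x| ≤ B) (hy : |y| ≤ B) :
    |x * y| ≤ B ^ 2 := by
  rw [abs_mul, sq]
  exact mul_le_mul hx hy (abs_nonneg _) hB

/-- **A constant bound for the energy-derivative integrand** in terms of a common strip bound
`B ≥ 1` of the fourteen quantities `ωᵢ, ωᵢ′, θᵢ, θᵢ′, θᵢ″, uᵢ, uᵢ′`. [folklore] -/
private theorem abs_rate_le {B a₁ a₂ da₁ da₂ b₁ b₂ db₁ db₂ ddb₁ ddb₂ u₁ u₂ du₁ du₂ : ℝ} (hB : 1 ≤ B)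
    (ha₁ : |a₁| ≤ B) (hda₁ : |da₁| ≤ B) (hb₁ : |b₁| ≤ B) (hdb₁ : |db₁| ≤ B) (hddb₁ : |ddb₁| ≤ B)
    (hu₁ : |u₁| ≤ B) (hdu₁ : |du₁| ≤ B)
    (ha₂ : |a₂| ≤ B) (hda₂ : |da₂| ≤ B) (hb₂ : |b₂| ≤ B) (hdb₂ : |db₂| ≤ B) (hddb₂ : |ddb₂| ≤ B)
    (hu₂ : |u₂| ≤ B) (hdu₂ : |du₂| ≤ B) :
    |2 * (a₁ - a₂) * ((-(u₁ * da₁) + db₁) - (-(u₂ * da₂) + db₂)) +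
        2 * (b₁ - b₂) * (-(u₁ * db₁) - -(u₂ * db₂)) +
        2 * (db₁ - db₂) * (-(u₁ * ddb₁ + du₁ * db₁) - -(u₂ * ddb₂ + du₂ * db₂))| ≤
      2 * (B + B) * ((B ^ 2 + B) + (B ^ 2 + B)) + 2 * (B + B) * (B ^ 2 + B ^ 2) +
        2 * (B + B) * ((B ^ 2 + B ^ 2) + (B ^ 2 + B ^ 2)) := by
  have hB0 : 0 ≤ B := by linarith
  -- the three differences
  have d1 : |a₁ - a₂| ≤ B + B := (abs_sub_le_add _ _).trans (add_le_add ha₁ ha₂)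
  have d2 : |b₁ - b₂| ≤ B + B := (abs_sub_le_add _ _).trans (add_le_add hb₁ hb₂)
  have d3 : |db₁ - db₂| ≤ B + B := (abs_sub_le_add _ _).trans (add_le_add hdb₁ hdb₂)
  -- the three right-hand sides
  have r1a : |(-(u₁ * da₁) + db₁)| ≤ B ^ 2 + B :=
    (abs_add_le _ _).trans (add_le_add (by rw [abs_neg]; exact abs_mul_le_sq hB0 hu₁ hda₁) hdb₁)
  have r1b : |(-(u₂ * da₂) + db₂)| ≤ B ^ 2 + B :=
    (abs_add_le _ _).trans (add_le_add (by rw [abs_neg]; exact abs_mul_le_sq hB0 hu₂ hda₂) hdb₂)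
  have r1 : |(-(u₁ * da₁) + db₁) - (-(u₂ * da₂) + db₂)| ≤ (B ^ 2 + B) + (B ^ 2 + B) :=
    (abs_sub_le_add _ _).trans (add_le_add r1a r1b)
  have r2 : |(-(u₁ * db₁) - -(u₂ * db₂))| ≤ B ^ 2 + B ^ 2 := by
    refine (abs_sub_le_add _ _).trans (add_le_add ?_ ?_)
    · rw [abs_neg]; exact abs_mul_le_sq hB0 hu₁ hdb₁
    · rw [abs_neg]; exact abs_mul_le_sq hB0 hu₂ hdb₂
  have r3a : |(u₁ * ddb₁ + du₁ * db₁)| ≤ B ^ 2 + B ^ 2 :=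
    (abs_add_le _ _).trans (add_le_add (abs_mul_le_sq hB0 hu₁ hddb₁) (abs_mul_le_sq hB0 hdu₁ hdb₁))
  have r3b : |(u₂ * ddb₂ + du₂ * db₂)| ≤ B ^ 2 + B ^ 2 :=
    (abs_add_le _ _).trans (add_le_add (abs_mul_le_sq hB0 hu₂ hddb₂) (abs_mul_le_sq hB0 hdu₂ hdb₂))
  have r3 : |(-(u₁ * ddb₁ + du₁ * db₁) - -(u₂ * ddb₂ + du₂ * db₂))| ≤
      (B ^ 2 + B ^ 2) + (B ^ 2 + B ^ 2) := by
    refine (abs_sub_le_add _ _).trans (add_le_add ?_ ?_)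
    · rw [abs_neg]; exact r3a
    · rw [abs_neg]; exact r3b
  -- products `|2 d r| = 2|d||r|`
  have prod : ∀ {d r D R : ℝ}, |d| ≤ D → |r| ≤ R → |2 * d * r| ≤ 2 * D * R := by
    intro d r D R hd hr
    rw [abs_mul, abs_mul, abs_two]
    have hD : 0 ≤ D := (abs_nonneg _).trans hd
    exact mul_le_mul (mul_le_mul_of_nonneg_left hd (by norm_num)) hr (abs_nonneg _) (by positivity)
  refine (abs_add_le _ _).trans (add_le_add ((abs_add_le _ _).trans (add_le_add ?_ ?_)) ?_)
  · exact prod d1 r1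
  · exact prod d2 r2
  · exact prod d3 r3

/-- **`dE/dt = ∫₀ᴸ G`** for the energy `E(s) = ∫₀ᴸ (w² + ϑ² + ϑ_x²)` of the difference
`(w, ϑ) = (ω₁ − ω₂, θ₁ − θ₂)` of two global smooth `L`-periodic HL solutions (`L > 0`), at every
`t ∈ (0,T)`: differentiation under the integral sign, the `s`-derivatives of `ωᵢ(s,x)`, `θᵢ(s,x)`
being the HL right-hand sides (the solution notion) and that of `θᵢ,ₓ(s,x)` the `θ_x`-equation
(`hasDerivAt_deriv_theta`), all bounded by a constant on the strip (`exists_strip_bounds₂`).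
[cite: ChoiHouKiselevLuoSverakYao2017, §2 p. 6 (bkmq) and §4 p. 11 (transport structure of (hl))] -/
theorem hasDerivAt_energy {L T : ℝ} (hL : 0 < L) (hT : 0 < T) {ω₀ θ₀ : ℝ → ℝ}
    {ω₁ θ₁ ω₂ θ₂ : ℝ → ℝ → ℝ}
    (h₁ : IsGlobalSmoothPeriodicHouLuoSolution L ω₀ θ₀ ω₁ θ₁)
    (h₂ : IsGlobalSmoothPeriodicHouLuoSolution L ω₀ θ₀ ω₂ θ₂) {t : ℝ} (ht : t ∈ Ioo 0 T) :
    HasDerivAt (fun s => ∫ x in (0 : ℝ)..L,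
        ((ω₁ s x - ω₂ s x) ^ 2 + (θ₁ s x - θ₂ s x) ^ 2 + (deriv (θ₁ s) x - deriv (θ₂ s) x) ^ 2))
      (∫ x in (0 : ℝ)..L,
        (2 * (ω₁ t x - ω₂ t x) *
            ((-(periodicHLVelocity L (ω₁ t) x * deriv (ω₁ t) x) + deriv (θ₁ t) x) -
              (-(periodicHLVelocity L (ω₂ t) x * deriv (ω₂ t) x) + deriv (θ₂ t) x)) +
          2 * (θ₁ t x - θ₂ t x) *
            (-(periodicHLVelocity L (ω₁ t) x * deriv (θ₁ t) x) -
              -(periodicHLVelocity L (ω₂ t) x * deriv (θ₂ t) x)) +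
          2 * (deriv (θ₁ t) x - deriv (θ₂ t) x) *
            (-(periodicHLVelocity L (ω₁ t) x * deriv (deriv (θ₁ t)) x +
                deriv (periodicHLVelocity L (ω₁ t)) x * deriv (θ₁ t) x) -
              -(periodicHLVelocity L (ω₂ t) x * deriv (deriv (θ₂ t)) x +
                deriv (periodicHLVelocity L (ω₂ t)) x * deriv (θ₂ t) x)))) t := by
  obtain ⟨B, hB1, hb₁, hb₂⟩ := exists_strip_bounds₂ (T := T) hL hT h₁ h₂
  obtain ⟨hsolT₁, hωs₁, hθs₁, -, -⟩ := h₁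
  obtain ⟨hsolT₂, hωs₂, hθs₂, -, -⟩ := h₂
  have hsol₁ : IsPeriodicHouLuoSolution L ω₁ θ₁ (T + 1) := hsolT₁ (T + 1) (by linarith)
  have hsol₂ : IsPeriodicHouLuoSolution L ω₂ θ₂ (T + 1) := hsolT₂ (T + 1) (by linarith)
  -- the neighbourhood `S = (t/2, T)` of `t`
  set S : Set ℝ := Ioo (t / 2) T with hS
  have hSmem : S ∈ 𝓝 t := Ioo_mem_nhds (by linarith [ht.1]) ht.2
  have hSsub : ∀ s ∈ S, s ∈ Icc 0 T ∧ s ∈ Ioo 0 (T + 1) := fun s hs =>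
    ⟨⟨by linarith [hs.1, ht.1], hs.2.le⟩, ⟨by linarith [hs.1, ht.1], by linarith [hs.2]⟩⟩
  have htS : t ∈ S := ⟨by linarith [ht.1], ht.2⟩
  -- slice regularity on the strip
  have hωC1₁ : ∀ s ∈ Icc 0 T, ContDiff ℝ 1 (ω₁ s) := fun s hs =>
    (contDiff_infty.1 (contDiff_slice' hωs₁ hs.1)) 1
  have hωC1₂ : ∀ s ∈ Icc 0 T, ContDiff ℝ 1 (ω₂ s) := fun s hs =>
    (contDiff_infty.1 (contDiff_slice' hωs₂ hs.1)) 1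
  have hθC2₁ : ∀ s ∈ Icc 0 T, ContDiff ℝ 2 (θ₁ s) := fun s hs =>
    (contDiff_infty.1 (contDiff_slice' hθs₁ hs.1)) 2
  have hθC2₂ : ∀ s ∈ Icc 0 T, ContDiff ℝ 2 (θ₂ s) := fun s hs =>
    (contDiff_infty.1 (contDiff_slice' hθs₂ hs.1)) 2
  have hωper₁ : ∀ s ∈ Icc 0 T, Function.Periodic (ω₁ s) L := fun s hs =>
    (hsol₁.1 s ⟨hs.1, by linarith [hs.2]⟩).2.2.1
  have hωper₂ : ∀ s ∈ Icc 0 T, Function.Periodic (ω₂ s) L := fun s hs =>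
    (hsol₂.1 s ⟨hs.1, by linarith [hs.2]⟩).2.2.1
  -- continuity of the slice quantities (for measurability)
  have hderivC1 : ∀ {g : ℝ → ℝ}, ContDiff ℝ 2 g → ContDiff ℝ 1 (deriv g) := by
    intro g hg
    have := (contDiff_succ_iff_deriv.1
      (show ContDiff ℝ ((1 : ℕ) + 1) g by exact_mod_cast hg)).2.2
    exact_mod_cast this
  have hsliceCont : ∀ s ∈ Icc 0 T,
      Continuous (ω₁ s) ∧ Continuous (ω₂ s) ∧ Continuous (θ₁ s) ∧ Continuous (θ₂ s) ∧
      Continuous (deriv (ω₁ s)) ∧ Continuous (deriv (ω₂ s)) ∧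
      Continuous (deriv (θ₁ s)) ∧ Continuous (deriv (θ₂ s)) ∧
      Continuous (deriv (deriv (θ₁ s))) ∧ Continuous (deriv (deriv (θ₂ s))) ∧
      Continuous (periodicHLVelocity L (ω₁ s)) ∧ Continuous (periodicHLVelocity L (ω₂ s)) ∧
      Continuous (deriv (periodicHLVelocity L (ω₁ s))) ∧
      Continuous (deriv (periodicHLVelocity L (ω₂ s))) := by
    intro s hs
    have u1 : ContDiff ℝ 1 (periodicHLVelocity L (ω₁ s)) :=
      contDiff_periodicHLVelocity hL 1 (hωC1₁ s hs) (hωper₁ s hs)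
    have u2 : ContDiff ℝ 1 (periodicHLVelocity L (ω₂ s)) :=
      contDiff_periodicHLVelocity hL 1 (hωC1₂ s hs) (hωper₂ s hs)
    exact ⟨(hωC1₁ s hs).continuous, (hωC1₂ s hs).continuous, (hθC2₁ s hs).continuous,
      (hθC2₂ s hs).continuous, (hωC1₁ s hs).continuous_deriv le_rfl,
      (hωC1₂ s hs).continuous_deriv le_rfl, (hderivC1 (hθC2₁ s hs)).continuous,
      (hderivC1 (hθC2₂ s hs)).continuous, (hderivC1 (hθC2₁ s hs)).continuous_deriv le_rfl,
      (hderivC1 (hθC2₂ s hs)).continuous_deriv le_rfl, u1.continuous, u2.continuous,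
      u1.continuous_deriv le_rfl, u2.continuous_deriv le_rfl⟩
  -- the time derivatives (solution notion + the `θ_x`-equation)
  have hθ2₁ : ContDiffOn ℝ 2 (fun p : ℝ × ℝ => θ₁ p.1 p.2) (Ioo 0 (T + 1) ×ˢ univ) :=
    ((contDiffOn_infty.1 hθs₁) 2).mono fun p hp => hp.1.1.le
  have hθ2₂ : ContDiffOn ℝ 2 (fun p : ℝ × ℝ => θ₂ p.1 p.2) (Ioo 0 (T + 1) ×ˢ univ) :=
    ((contDiffOn_infty.1 hθs₂) 2).mono fun p hp => hp.1.1.le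
  have hω1₁ : ∀ s ∈ Ioo 0 (T + 1), ContDiff ℝ 1 (ω₁ s) := fun s hs =>
    (contDiff_infty.1 (contDiff_slice' hωs₁ hs.1.le)) 1
  have hω1₂ : ∀ s ∈ Ioo 0 (T + 1), ContDiff ℝ 1 (ω₂ s) := fun s hs =>
    (contDiff_infty.1 (contDiff_slice' hωs₂ hs.1.le)) 1
  -- the data for the parametric-integral lemma
  set F : ℝ → ℝ → ℝ := fun s x =>
    (ω₁ s x - ω₂ s x) ^ 2 + (θ₁ s x - θ₂ s x) ^ 2 + (deriv (θ₁ s) x - deriv (θ₂ s) x) ^ 2 with hF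
  set F' : ℝ → ℝ → ℝ := fun s x =>
    2 * (ω₁ s x - ω₂ s x) *
        ((-(periodicHLVelocity L (ω₁ s) x * deriv (ω₁ s) x) + deriv (θ₁ s) x) -
          (-(periodicHLVelocity L (ω₂ s) x * deriv (ω₂ s) x) + deriv (θ₂ s) x)) +
      2 * (θ₁ s x - θ₂ s x) *
        (-(periodicHLVelocity L (ω₁ s) x * deriv (θ₁ s) x) -
          -(periodicHLVelocity L (ω₂ s) x * deriv (θ₂ s) x)) +
      2 * (deriv (θ₁ s) x - deriv (θ₂ s) x) *
        (-(periodicHLVelocity L (ω₁ s) x * deriv (deriv (θ₁ s)) x +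
            deriv (periodicHLVelocity L (ω₁ s)) x * deriv (θ₁ s) x) -
          -(periodicHLVelocity L (ω₂ s) x * deriv (deriv (θ₂ s)) x +
            deriv (periodicHLVelocity L (ω₂ s)) x * deriv (θ₂ s) x)) with hF'
  have hFcont : ∀ s ∈ Icc 0 T, Continuous (F s) := by
    intro s hs
    obtain ⟨c1, c2, c3, c4, -, -, c7, c8, -⟩ := hsliceCont s hs
    simp only [hF]
    fun_prop
  have hF'cont : ∀ s ∈ Icc 0 T, Continuous (F' s) := by
    intro s hs
    obtain ⟨c1, c2, c3, c4, c5, c6, c7, c8, c9, c10, c11, c12, c13, c14⟩ := hsliceCont s hs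
    simp only [hF']
    fun_prop
  have hF_meas : ∀ᶠ s in 𝓝 t, AEStronglyMeasurable (F s) (volume.restrict (uIoc 0 L)) := by
    filter_upwards [hSmem] with s hs
    exact (hFcont s (hSsub s hs).1).aestronglyMeasurable
  have hF_int : IntervalIntegrable (F t) volume 0 L := (hFcont t (hSsub t htS).1).intervalIntegrable _ _
  have hF'_meas : AEStronglyMeasurable (F' t) (volume.restrict (uIoc 0 L)) :=
    (hF'cont t (hSsub t htS).1).aestronglyMeasurable
  have h_bound : ∀ᵐ x ∂(volume : Measure ℝ), x ∈ uIoc 0 L → ∀ s ∈ S,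
      ‖F' s x‖ ≤ 2 * (B + B) * ((B ^ 2 + B) + (B ^ 2 + B)) + 2 * (B + B) * (B ^ 2 + B ^ 2) +
        2 * (B + B) * ((B ^ 2 + B ^ 2) + (B ^ 2 + B ^ 2)) := by
    refine Eventually.of_forall fun x _ s hs => ?_
    obtain ⟨e1, e2, e3, e4, e5, e6, e7⟩ := hb₁ s (hSsub s hs).1 x
    obtain ⟨f1, f2, f3, f4, f5, f6, f7⟩ := hb₂ s (hSsub s hs).1 x
    rw [Real.norm_eq_abs]
    simp only [hF']
    exact abs_rate_le hB1 e1 e2 e3 e4 e5 e6 e7 f1 f2 f3 f4 f5 f6 f7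
  have h_diff : ∀ᵐ x ∂(volume : Measure ℝ), x ∈ uIoc 0 L → ∀ s ∈ S,
      HasDerivAt (fun s => F s x) (F' s x) s := by
    refine Eventually.of_forall fun x _ s hs => ?_
    have hs' := (hSsub s hs).2
    have dω₁ := (hsol₁.2.2 s hs' x).1
    have dω₂ := (hsol₂.2.2 s hs' x).1
    have dθ₁ := (hsol₁.2.2 s hs' x).2
    have dθ₂ := (hsol₂.2.2 s hs' x).2
    have dθx₁ := hasDerivAt_deriv_theta hL hsol₁ hθ2₁ hω1₁ hs' x
    have dθx₂ := hasDerivAt_deriv_theta hL hsol₂ hθ2₂ hω1₂ hs' x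
    have e1 : HasDerivAt (fun r => (ω₁ r x - ω₂ r x) ^ 2)
        (((2 : ℕ) : ℝ) * (ω₁ s x - ω₂ s x) ^ (2 - 1) *
          ((-(periodicHLVelocity L (ω₁ s) x * deriv (ω₁ s) x) + deriv (θ₁ s) x) -
            (-(periodicHLVelocity L (ω₂ s) x * deriv (ω₂ s) x) + deriv (θ₂ s) x))) s :=
      (dω₁.sub dω₂).pow 2
    have e2 : HasDerivAt (fun r => (θ₁ r x - θ₂ r x) ^ 2)
        (((2 : ℕ) : ℝ) * (θ₁ s x - θ₂ s x) ^ (2 - 1) *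
          (-(periodicHLVelocity L (ω₁ s) x * deriv (θ₁ s) x) -
            -(periodicHLVelocity L (ω₂ s) x * deriv (θ₂ s) x))) s :=
      (dθ₁.sub dθ₂).pow 2
    have e3 : HasDerivAt (fun r => (deriv (θ₁ r) x - deriv (θ₂ r) x) ^ 2)
        (((2 : ℕ) : ℝ) * (deriv (θ₁ s) x - deriv (θ₂ s) x) ^ (2 - 1) *
          (-(periodicHLVelocity L (ω₁ s) x * deriv (deriv (θ₁ s)) x +
              deriv (periodicHLVelocity L (ω₁ s)) x * deriv (θ₁ s) x) -
            -(periodicHLVelocity L (ω₂ s) x * deriv (deriv (θ₂ s)) x +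
              deriv (periodicHLVelocity L (ω₂ s)) x * deriv (θ₂ s) x))) s :=
      (dθx₁.sub dθx₂).pow 2
    have e := (e1.add e2).add e3
    refine (e.congr_of_eventuallyEq (Eventually.of_forall fun r => ?_)).congr_deriv ?_
    · simp only [hF, Pi.add_apply]
    · simp only [hF']
      push_cast
      ring
  have hmain := intervalIntegral.hasDerivAt_integral_of_dominated_loc_of_deriv_le
    (μ := volume) (a := 0) (b := L) hSmem hF_meas hF_int hF'_meas h_bound
    intervalIntegrable_const h_diff
  exact hmain.2

/-- **Continuity of the energy on `[0,∞)`**: `s ↦ E(s) = ∫₀ᴸ (w² + ϑ² + ϑ_x²)` is continuous within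
`[0,∞)` at every `t₀ ≥ 0` — dominated convergence with a constant bound on a time strip, the
integrand being jointly continuous up to `t = 0` (joint `C^∞` on `{t ≥ 0}`).
[cite: ChoiHouKiselevLuoSverakYao2017, §2 p. 6 (bkmq) and §2.1 Thm 1 p. 6 (smooth global solution)] -/
theorem continuousWithinAt_energy {L : ℝ} (hL : 0 < L) {ω₀ θ₀ : ℝ → ℝ} {ω₁ θ₁ ω₂ θ₂ : ℝ → ℝ → ℝ}
    (h₁ : IsGlobalSmoothPeriodicHouLuoSolution L ω₀ θ₀ ω₁ θ₁)
    (h₂ : IsGlobalSmoothPeriodicHouLuoSolution L ω₀ θ₀ ω₂ θ₂) {t₀ : ℝ} (ht₀ : 0 ≤ t₀) :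
    ContinuousWithinAt (fun s => ∫ x in (0 : ℝ)..L,
        ((ω₁ s x - ω₂ s x) ^ 2 + (θ₁ s x - θ₂ s x) ^ 2 + (deriv (θ₁ s) x - deriv (θ₂ s) x) ^ 2))
      (Ici 0) t₀ := by
  set T : ℝ := t₀ + 1 with hT
  have hT0 : 0 < T := by linarith
  obtain ⟨B, hB1, hb₁, hb₂⟩ := exists_strip_bounds₂ (T := T) hL hT0 h₁ h₂
  obtain ⟨hsolT₁, hωs₁, hθs₁, -, -⟩ := h₁
  obtain ⟨hsolT₂, hωs₂, hθs₂, -, -⟩ := h₂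
  have hB0 : 0 ≤ B := by linarith
  -- the neighbourhood `[0, T)` of `t₀` within `[0, ∞)`
  have hN : Ico 0 T ∈ 𝓝[Ici 0] t₀ := by
    have h : Ici 0 ∩ Iio T ∈ 𝓝[Ici 0] t₀ :=
      inter_mem_nhdsWithin (Ici 0) (Iio_mem_nhds (by linarith : t₀ < T))
    exact Filter.mem_of_superset h fun s hs => ⟨hs.1, hs.2⟩
  have hωs1₁ : ContDiffOn ℝ 1 (fun p : ℝ × ℝ => ω₁ p.1 p.2) {p : ℝ × ℝ | 0 ≤ p.1} :=
    hωs₁.of_le (by exact_mod_cast (le_top : (1 : ℕ∞) ≤ ⊤))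
  have hωs1₂ : ContDiffOn ℝ 1 (fun p : ℝ × ℝ => ω₂ p.1 p.2) {p : ℝ × ℝ | 0 ≤ p.1} :=
    hωs₂.of_le (by exact_mod_cast (le_top : (1 : ℕ∞) ≤ ⊤))
  have hθs1₁ : ContDiffOn ℝ 1 (fun p : ℝ × ℝ => θ₁ p.1 p.2) {p : ℝ × ℝ | 0 ≤ p.1} :=
    hθs₁.of_le (by exact_mod_cast (le_top : (1 : ℕ∞) ≤ ⊤))
  have hθs1₂ : ContDiffOn ℝ 1 (fun p : ℝ × ℝ => θ₂ p.1 p.2) {p : ℝ × ℝ | 0 ≤ p.1} :=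
    hθs₂.of_le (by exact_mod_cast (le_top : (1 : ℕ∞) ≤ ⊤))
  -- slice continuity on the strip (for measurability)
  have hslice : ∀ s ∈ Ico 0 T, Continuous (ω₁ s) ∧ Continuous (ω₂ s) ∧ Continuous (θ₁ s) ∧
      Continuous (θ₂ s) ∧ Continuous (deriv (θ₁ s)) ∧ Continuous (deriv (θ₂ s)) := by
    intro s hs
    have a1 : ContDiff ℝ 1 (ω₁ s) := (contDiff_infty.1 (contDiff_slice' hωs₁ hs.1)) 1
    have a2 : ContDiff ℝ 1 (ω₂ s) := (contDiff_infty.1 (contDiff_slice' hωs₂ hs.1)) 1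
    have a3 : ContDiff ℝ 1 (θ₁ s) := (contDiff_infty.1 (contDiff_slice' hθs₁ hs.1)) 1
    have a4 : ContDiff ℝ 1 (θ₂ s) := (contDiff_infty.1 (contDiff_slice' hθs₂ hs.1)) 1
    exact ⟨a1.continuous, a2.continuous, a3.continuous, a4.continuous,
      a3.continuous_deriv le_rfl, a4.continuous_deriv le_rfl⟩
  -- pointwise continuity of the integrand within `[0, ∞)`, from joint continuity up to `t = 0`
  have hι : ∀ x : ℝ, ContinuousOn (fun s : ℝ => (s, x)) (Ici 0) := fun x =>
    (continuous_id.prodMk continuous_const).continuousOn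
  have hmaps : ∀ x : ℝ, MapsTo (fun s : ℝ => (s, x)) (Ici 0) {p : ℝ × ℝ | 0 ≤ p.1} :=
    fun x s hs => hs
  have hpt : ∀ x, ContinuousWithinAt (fun s => ω₁ s x) (Ici 0) t₀ ∧
      ContinuousWithinAt (fun s => ω₂ s x) (Ici 0) t₀ ∧
      ContinuousWithinAt (fun s => θ₁ s x) (Ici 0) t₀ ∧
      ContinuousWithinAt (fun s => θ₂ s x) (Ici 0) t₀ ∧
      ContinuousWithinAt (fun s => deriv (θ₁ s) x) (Ici 0) t₀ ∧
      ContinuousWithinAt (fun s => deriv (θ₂ s) x) (Ici 0) t₀ := by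
    intro x
    have c1 : ContinuousOn (fun s => ω₁ s x) (Ici 0) := hωs₁.continuousOn.comp (hι x) (hmaps x)
    have c2 : ContinuousOn (fun s => ω₂ s x) (Ici 0) := hωs₂.continuousOn.comp (hι x) (hmaps x)
    have c3 : ContinuousOn (fun s => θ₁ s x) (Ici 0) := hθs₁.continuousOn.comp (hι x) (hmaps x)
    have c4 : ContinuousOn (fun s => θ₂ s x) (Ici 0) := hθs₂.continuousOn.comp (hι x) (hmaps x)
    have c5 : ContinuousOn (fun s => deriv (θ₁ s) x) (Ici 0) :=
      (continuousOn_deriv_slice'' hθs1₁).comp (hι x) (hmaps x)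
    have c6 : ContinuousOn (fun s => deriv (θ₂ s) x) (Ici 0) :=
      (continuousOn_deriv_slice'' hθs1₂).comp (hι x) (hmaps x)
    exact ⟨c1.continuousWithinAt ht₀, c2.continuousWithinAt ht₀, c3.continuousWithinAt ht₀,
      c4.continuousWithinAt ht₀, c5.continuousWithinAt ht₀, c6.continuousWithinAt ht₀⟩
  refine intervalIntegral.continuousWithinAt_of_dominated_interval
    (bound := fun _ => (B + B) ^ 2 + (B + B) ^ 2 + (B + B) ^ 2) ?_ ?_ intervalIntegrable_const ?_
  · filter_upwards [hN] with s hs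
    obtain ⟨c1, c2, c3, c4, c5, c6⟩ := hslice s hs
    exact (((c1.sub c2).pow 2).add ((c3.sub c4).pow 2) |>.add ((c5.sub c6).pow 2)
      |>.aestronglyMeasurable).congr (Eventually.of_forall fun x => by
        simp only [Pi.add_apply, Pi.pow_apply, Pi.sub_apply])
  · filter_upwards [hN] with s hs
    refine Eventually.of_forall fun x _ => ?_
    have hsT : s ∈ Icc 0 T := ⟨hs.1, hs.2.le⟩
    obtain ⟨e1, -, e3, e4, -⟩ := hb₁ s hsT x
    obtain ⟨f1, -, f3, f4, -⟩ := hb₂ s hsT x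
    have d1 : |ω₁ s x - ω₂ s x| ≤ B + B := (abs_sub_le_add _ _).trans (add_le_add e1 f1)
    have d2 : |θ₁ s x - θ₂ s x| ≤ B + B := (abs_sub_le_add _ _).trans (add_le_add e3 f3)
    have d3 : |deriv (θ₁ s) x - deriv (θ₂ s) x| ≤ B + B :=
      (abs_sub_le_add _ _).trans (add_le_add e4 f4)
    have s1 : (ω₁ s x - ω₂ s x) ^ 2 ≤ (B + B) ^ 2 := by
      rw [← sq_abs]; exact pow_le_pow_left₀ (abs_nonneg _) d1 2
    have s2 : (θ₁ s x - θ₂ s x) ^ 2 ≤ (B + B) ^ 2 := by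
      rw [← sq_abs]; exact pow_le_pow_left₀ (abs_nonneg _) d2 2
    have s3 : (deriv (θ₁ s) x - deriv (θ₂ s) x) ^ 2 ≤ (B + B) ^ 2 := by
      rw [← sq_abs]; exact pow_le_pow_left₀ (abs_nonneg _) d3 2
    rw [Real.norm_eq_abs, abs_of_nonneg (by positivity)]
    linarith
  · refine Eventually.of_forall fun x _ => ?_
    obtain ⟨c1, c2, c3, c4, c5, c6⟩ := hpt x
    exact (((c1.sub c2).pow 2).add ((c3.sub c4).pow 2)).add ((c5.sub c6).pow 2)

end ChoiEtAl2017

/-! ### §5 Uniqueness of global smooth periodic HL solutions -/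

/-- **UNIQUENESS of global smooth `L`-periodic solutions of the Hou–Luo model** (`L > 0`): two
global smooth solutions (`IsGlobalSmoothPeriodicHouLuoSolution`: classical on every `[0,T)`,
jointly `C^∞` on `{t ≥ 0}`) from the same datum `(ω₀, θ₀)` coincide at all times `t ≥ 0`. This is
the uniqueness part of "the local well-posedness … (bkmq) … standard arguments" (§2 p. 6) that the
proof of Theorem 1 uses on p. 11 ("the evolution preserves the assumptions"); proof by the energy
`E = ‖ω₁−ω₂‖² + ‖θ₁−θ₂‖² + ‖(θ₁−θ₂)_x‖²_{L²(0,L)}`: `E′ ≤ KE` (`hasDerivAt_energy`,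
`energy_dissipation_le`), `E(0) = 0`, so `e^{−Kt}E` is nonincreasing (`antitoneOn_of_deriv_nonpos`)
and `E ≡ 0`; a continuous nonnegative integrand with zero integral vanishes. Hypothesis (U) of
`ChoiEtAl2017.not_isGlobalSmooth_of_unique_of_lemma7`.
[cite: ChoiHouKiselevLuoSverakYao2017, §2 p. 6 (bkmq: local well-posedness) and §4 p. 11 (the evolution preserves the assumptions)] -/
theorem IsGlobalSmoothPeriodicHouLuoSolution.unique {L : ℝ} (hL : 0 < L) {ω₀ θ₀ : ℝ → ℝ}
    {ω₁ θ₁ ω₂ θ₂ : ℝ → ℝ → ℝ}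
    (h₁ : IsGlobalSmoothPeriodicHouLuoSolution L ω₀ θ₀ ω₁ θ₁)
    (h₂ : IsGlobalSmoothPeriodicHouLuoSolution L ω₀ θ₀ ω₂ θ₂) (t : ℝ) (ht : 0 ≤ t) :
    ω₁ t = ω₂ t ∧ θ₁ t = θ₂ t := by
  set T : ℝ := t + 1 with hT
  have hT0 : 0 < T := by linarith
  have htT : t < T := by linarith
  obtain ⟨B, hB1, hb₁, hb₂⟩ := ChoiEtAl2017.exists_strip_bounds₂ (T := T) hL hT0 h₁ h₂
  have hB0 : 0 ≤ B := by linarith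
  have hsol₁ : IsPeriodicHouLuoSolution L ω₁ θ₁ T := h₁.1 T hT0
  have hsol₂ : IsPeriodicHouLuoSolution L ω₂ θ₂ T := h₂.1 T hT0
  -- the energy, its derivative integrand, the Gronwall constant
  set E : ℝ → ℝ := fun s => ∫ x in (0 : ℝ)..L,
    ((ω₁ s x - ω₂ s x) ^ 2 + (θ₁ s x - θ₂ s x) ^ 2 + (deriv (θ₁ s) x - deriv (θ₂ s) x) ^ 2) with hE
  set D : ℝ → ℝ := fun s => ∫ x in (0 : ℝ)..L,
    (2 * (ω₁ s x - ω₂ s x) *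
        ((-(periodicHLVelocity L (ω₁ s) x * deriv (ω₁ s) x) + deriv (θ₁ s) x) -
          (-(periodicHLVelocity L (ω₂ s) x * deriv (ω₂ s) x) + deriv (θ₂ s) x)) +
      2 * (θ₁ s x - θ₂ s x) *
        (-(periodicHLVelocity L (ω₁ s) x * deriv (θ₁ s) x) -
          -(periodicHLVelocity L (ω₂ s) x * deriv (θ₂ s) x)) +
      2 * (deriv (θ₁ s) x - deriv (θ₂ s) x) *
        (-(periodicHLVelocity L (ω₁ s) x * deriv (deriv (θ₁ s)) x +
            deriv (periodicHLVelocity L (ω₁ s)) x * deriv (θ₁ s) x) -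
          -(periodicHLVelocity L (ω₂ s) x * deriv (deriv (θ₂ s)) x +
            deriv (periodicHLVelocity L (ω₂ s)) x * deriv (θ₂ s) x))) with hD
  set K : ℝ := 6 * B + 1 + 3 * B * (1 / π * ∫ z in (0 : ℝ)..L, |(Real.log |Real.sin (π * z / L)|)|) ^ 2
    with hK
  -- (i) `E′ = D` on `(0,T)`, (ii) `D ≤ K E` there
  have hderiv : ∀ s ∈ Ioo 0 T, HasDerivAt E (D s) s := fun s hs =>
    ChoiEtAl2017.hasDerivAt_energy hL hT0 h₁ h₂ hs
  have hDle : ∀ s ∈ Ioo 0 T, D s ≤ K * E s := by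
    intro s hs
    have hsI : s ∈ Ico 0 T := ⟨hs.1.le, hs.2⟩
    have hsC : s ∈ Icc 0 T := ⟨hs.1.le, hs.2.le⟩
    obtain ⟨hω₁, hθ₁, pω₁, pθ₁⟩ := hsol₁.1 s hsI
    obtain ⟨hω₂, hθ₂, pω₂, pθ₂⟩ := hsol₂.1 s hsI
    exact ChoiEtAl2017.energy_dissipation_le hL hω₁ hω₂ hθ₁ hθ₂ pω₁ pω₂ pθ₁ pθ₂ hB0 fun x =>
      ⟨(hb₁ s hsC x).2.2.2.2.2.2, (hb₂ s hsC x).2.1, (hb₂ s hsC x).2.2.2.1, (hb₂ s hsC x).2.2.2.2.1⟩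
  -- (iii) `E` is continuous on `[0,T]`, nonnegative, and `E(0) = 0`
  have hEcont : ContinuousOn E (Icc 0 T) := fun s hs =>
    (ChoiEtAl2017.continuousWithinAt_energy hL h₁ h₂ hs.1).mono Icc_subset_Ici_self
  have hEnn : ∀ s, 0 ≤ E s := fun s =>
    intervalIntegral.integral_nonneg hL.le fun x _ => by positivity
  have hE0 : E 0 = 0 := by
    have e1 : ω₁ 0 = ω₂ 0 := by rw [h₁.2.2.2.1, h₂.2.2.2.1]
    have e2 : θ₁ 0 = θ₂ 0 := by rw [h₁.2.2.2.2, h₂.2.2.2.2]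
    simp only [hE, e1, e2, sub_self]
    simp
  -- (iv) Gronwall: `Φ = e^{−Ks} E(s)` is nonincreasing on `[0,T]`
  set Φ : ℝ → ℝ := fun s => Real.exp (-K * s) * E s with hΦ
  have hΦderiv : ∀ s ∈ Ioo 0 T,
      HasDerivAt Φ (Real.exp (-K * s) * (-K) * E s + Real.exp (-K * s) * D s) s := by
    intro s hs
    have h1 : HasDerivAt (fun y : ℝ => -K * y) (-K) s := by
      simpa using (hasDerivAt_id s).const_mul (-K)
    exact (h1.exp).mul (hderiv s hs)
  have hΦcont : ContinuousOn Φ (Icc 0 T) :=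
    ((Real.continuous_exp.comp (continuous_const.mul continuous_id)).continuousOn).mul hEcont
  have hΦdiff : DifferentiableOn ℝ Φ (interior (Icc 0 T)) := by
    rw [interior_Icc]
    exact fun s hs => (hΦderiv s hs).differentiableAt.differentiableWithinAt
  have hΦle : ∀ s ∈ interior (Icc 0 T), deriv Φ s ≤ 0 := by
    rw [interior_Icc]
    intro s hs
    rw [(hΦderiv s hs).deriv]
    have hexp : 0 < Real.exp (-K * s) := Real.exp_pos _
    have := hDle s hs
    nlinarith
  have hanti := antitoneOn_of_deriv_nonpos (convex_Icc 0 T) hΦcont hΦdiff hΦle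
  have hΦt : Φ t ≤ Φ 0 := hanti (left_mem_Icc.2 hT0.le) ⟨ht, htT.le⟩ ht
  have hEt : E t = 0 := by
    have h0 : Φ 0 = 0 := by simp only [hΦ, hE0, mul_zero]
    rw [h0] at hΦt
    have hexp : 0 < Real.exp (-K * t) := Real.exp_pos _
    have : E t ≤ 0 := by
      by_contra hcon
      have hcon' : 0 < E t := lt_of_not_ge hcon
      have : 0 < Real.exp (-K * t) * E t := mul_pos hexp hcon'
      linarith
    exact le_antisymm this (hEnn t)
  -- (v) a continuous nonnegative integrand with zero integral vanishes on `(0, L]`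
  have htI : t ∈ Ico 0 T := ⟨ht, htT⟩
  obtain ⟨hω₁, hθ₁, pω₁, pθ₁⟩ := hsol₁.1 t htI
  obtain ⟨hω₂, hθ₂, pω₂, pθ₂⟩ := hsol₂.1 t htI
  set P : ℝ → ℝ := fun x =>
    (ω₁ t x - ω₂ t x) ^ 2 + (θ₁ t x - θ₂ t x) ^ 2 + (deriv (θ₁ t) x - deriv (θ₂ t) x) ^ 2 with hP
  have hPc : Continuous P := by
    have c1 := hω₁.continuous
    have c2 := hω₂.continuous
    have c3 := hθ₁.continuous
    have c4 := hθ₂.continuous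
    have c5 := hθ₁.continuous_deriv (by norm_num)
    have c6 := hθ₂.continuous_deriv (by norm_num)
    simp only [hP]
    fun_prop
  have hPnn : ∀ x, 0 ≤ P x := fun x => by simp only [hP]; positivity
  have hPint : (∫ x in (0 : ℝ)..L, P x) = 0 := hEt
  have hPae : P =ᵐ[volume.restrict (Ioc 0 L)] 0 :=
    (intervalIntegral.integral_eq_zero_iff_of_le_of_nonneg_ae hL.le
      (Eventually.of_forall fun x => hPnn x) (hPc.intervalIntegrable _ _)).1 hPint
  have hPzero : EqOn P 0 (Ioc 0 L) :=
    Measure.eqOn_Ioc_of_ae_eq volume hPae hPc.continuousOn continuousOn_const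
  -- periodic extension to all of `ℝ`
  have hPper : Function.Periodic P L := by
    intro x
    simp only [hP]
    rw [pω₁ x, pω₂ x, pθ₁ x, pθ₂ x, ChoiEtAl2017.periodic_deriv' pθ₁ x,
      ChoiEtAl2017.periodic_deriv' pθ₂ x]
  have hPall : ∀ x, P x = 0 := by
    intro x
    obtain ⟨y, hy, hxy⟩ := hPper.exists_mem_Ico₀ hL x
    rw [hxy]
    rcases eq_or_lt_of_le hy.1 with h0 | hpos
    · rw [← h0]
      have h := hPper 0
      rw [zero_add] at h
      rw [← h]
      exact hPzero ⟨hL, le_rfl⟩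
    · exact hPzero ⟨hpos, hy.2.le⟩
  -- conclusion
  have hsq : ∀ x, ω₁ t x - ω₂ t x = 0 ∧ θ₁ t x - θ₂ t x = 0 := by
    intro x
    have h := hPall x
    simp only [hP] at h
    have h1 : (ω₁ t x - ω₂ t x) ^ 2 = 0 := by
      nlinarith [sq_nonneg (ω₁ t x - ω₂ t x), sq_nonneg (θ₁ t x - θ₂ t x),
        sq_nonneg (deriv (θ₁ t) x - deriv (θ₂ t) x)]
    have h2 : (θ₁ t x - θ₂ t x) ^ 2 = 0 := by
      nlinarith [sq_nonneg (ω₁ t x - ω₂ t x), sq_nonneg (θ₁ t x - θ₂ t x),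
        sq_nonneg (deriv (θ₁ t) x - deriv (θ₂ t) x)]
    exact ⟨pow_eq_zero_iff (two_ne_zero) |>.1 h1, pow_eq_zero_iff (two_ne_zero) |>.1 h2⟩
  refine ⟨funext fun x => ?_, funext fun x => ?_⟩
  · exact sub_eq_zero.1 (hsq x).1
  · exact sub_eq_zero.1 (hsq x).2

end Literature.Analysis.FluidPDE
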